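import Summits.NavierStokesRegularity.NavierStokesRegularity.Theorems.SineMomentDoorSpread

/-!
# SineMomentDoorDoors — S27 «SineMomentDoor», the doors T-sine / T-sine-schema and the transverse-vorticity corollary

Landing (DIRECTOR-NS #88/#89, typer g20) of nsreg-p1 g22's ROUND-26 door file `r26/Sketch27.lean`
(sha16 b3e45f4d288a9931; farm rc 0, 0 sorry) as theorems-only tree files, statements and proofs VERBATIM,
split along the planner's section boundaries: `SineMomentDoorDefs` (§0 observable, §1 texts, §0′ elementary facts),
`SineMomentDoorSpread` (§2 (H1) zoom-closedness, §3 (H2) analytic spread, §4 (H3) stratum Liouville),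
`SineMomentDoorDoors` (§5 the doors, §6 the transverse-vorticity corollary), `SineMomentDoorSeq` (§7 the sequential
upgrade). This file: `sineStableStratum_holds`, `targetSineSchema_holds`, `targetSineMoment_holds` (§5) and `TargetTransverseVorticity` / `targetTransverseVorticity_holds` (§6); see `SineMomentDoorDefs` for the planner's full account.
WHAT THIS IS NOT: not NS regularity (`NoTypeII` untouched); an ε-criterion inside the Type-I class, MODEL-free.
-/

noncomputable section

open MeasureTheory Set Function Filter Topology TopologicalSpace Metric
open scoped RealInnerProductSpace NNReal ENNReal Topology Pointwise ContDiff
open Literature.Analysis Literature.Analysis.FluidPDE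
open Summit.NavierStokesRegularity.NavierStokesRegularity.Theorems.PoloidalWindowDoorPoloidalWindowRigidityWindow
open Summit.NavierStokesRegularity.NavierStokesRegularity.Theorems.ZoomReturnDoorDefs
open Summit.NavierStokesRegularity.NavierStokesRegularity.Theorems.StableStrataDoorDefs
open Summit.NavierStokesRegularity.NavierStokesRegularity.Theorems.StableStrataDoorWindowLimit
open Summit.NavierStokesRegularity.NavierStokesRegularity.Theorems.StableStrataDoorSchema
open Summit.NavierStokesRegularity.NavierStokesRegularity.Theorems.StableStrataDoorInstances
open Summit.NavierStokesRegularity.NavierStokesRegularity.Theorems.LocalSineTubeDoorProfileAlignedWindowRigidity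
open Summit.NavierStokesRegularity.NavierStokesRegularity.Theorems.LocalSineTubeDoorProfileAlignedWindowRigidityPlanarity

set_option linter.dupNamespace false

namespace Summit.NavierStokesRegularity.NavierStokesRegularity.Theorems.SineMomentDoor

/-! ## §5 THE DOORS -/

/-- **R-sine is a THEOREM** (schema: `stratumResidue_of_liouville`). -/
theorem sineStableStratum_holds : SineStableStratum := fun _ D _ U hν hD hB hU hne =>
  stratumResidue_of_liouville (𝔖 := uniStratum) hD (isWindowLsc_sinePhi U hB) (spreadsTo_sinePhi hν hU hne hB)
    (stratumLiouville_uni D)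

/-- **the schema door is a THEOREM** (schema: `stratumDoorAt_of_liouville`). -/
theorem targetSineSchema_holds : TargetSineSchema := fun ν M U hν hU hne =>
  stratumDoorAt_of_liouville (𝔖 := uniStratum) hν (isWindowLsc_sinePhi U (cap_pos ν M))
    (spreadsTo_sinePhi hν hU hne (cap_pos ν M)) (fun D _ => stratumLiouville_uni D) M

/-- under space–time local Type I with constant `M`, the scale-normalised velocity is EVENTUALLY capped by
`|M|/√ν < cap ν M` on every bounded set. -/
theorem eventually_norm_physWindowField_le {ν T M ρ : ℝ} (hν : 0 < ν) (hT : 0 < T) (hρ : 0 < ρ)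
    {u : ℝ → EuclideanSpace ℝ (Fin 3) → EuclideanSpace ℝ (Fin 3)} {x₀ : EuclideanSpace ℝ (Fin 3)}
    (hM : ∀ t ∈ Set.Ico 0 T, T - ρ ^ 2 < t → ∀ x ∈ Metric.ball x₀ ρ, ‖u t x‖ * (‖x - x₀‖ + Real.sqrt (ν * (T - t))) ≤ M)
    {K : Set (EuclideanSpace ℝ (Fin 3))} (hK : Bornology.IsBounded K) :
    ∀ᶠ t in nhdsWithin T (Set.Iio T), ∀ ζ ∈ K, ‖physWindowField T x₀ u t ζ‖ ≤ |M| / Real.sqrt ν := by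
  obtain ⟨R, hR⟩ := hK.subset_closedBall 0
  -- choose the time window: `0 ≤ t`, `T - ρ² < t`, `√(T - t) (|R| + 1) < ρ`
  set δ : ℝ := min T (min (ρ ^ 2) ((ρ / (|R| + 1)) ^ 2)) with hδ
  have hR1 : 0 < |R| + 1 := by positivity
  have hδpos : 0 < δ := by
    rw [hδ]; exact lt_min hT (lt_min (by positivity) (by positivity))
  have hmem : Set.Ioo (T - δ) T ∈ nhdsWithin T (Set.Iio T) := Ioo_mem_nhdsLT (by linarith)
  filter_upwards [hmem] with t ht ζ hζ
  have hTt : 0 < T - t := sub_pos.2 ht.2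
  have ht0 : 0 ≤ t := by
    have : δ ≤ T := min_le_left _ _
    linarith [ht.1]
  have htρ : T - ρ ^ 2 < t := by
    have : δ ≤ ρ ^ 2 := (min_le_right _ _).trans (min_le_left _ _)
    linarith [ht.1]
  have hsq : Real.sqrt (T - t) * (|R| + 1) < ρ := by
    have h1 : T - t < (ρ / (|R| + 1)) ^ 2 := by
      have : δ ≤ (ρ / (|R| + 1)) ^ 2 := (min_le_right _ _).trans (min_le_right _ _)
      linarith [ht.1]
    have h2 : Real.sqrt (T - t) < ρ / (|R| + 1) := by
      rw [Real.sqrt_lt' (by positivity)]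
      exact h1
    rwa [lt_div_iff₀ hR1] at h2
  have hζR : ‖ζ‖ ≤ |R| := by
    have := hR hζ
    rw [mem_closedBall, dist_zero_right] at this
    exact this.trans (le_abs_self R)
  set x : EuclideanSpace ℝ (Fin 3) := x₀ + Real.sqrt (T - t) • ζ with hx
  have hxx₀ : ‖x - x₀‖ = Real.sqrt (T - t) * ‖ζ‖ := by
    rw [hx, add_sub_cancel_left, norm_smul, Real.norm_of_nonneg (Real.sqrt_nonneg _)]
  have hxball : x ∈ Metric.ball x₀ ρ := by
    rw [mem_ball, dist_eq_norm, hxx₀]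
    calc Real.sqrt (T - t) * ‖ζ‖ ≤ Real.sqrt (T - t) * (|R| + 1) :=
          mul_le_mul_of_nonneg_left (by linarith) (Real.sqrt_nonneg _)
      _ < ρ := hsq
  have hb := hM t ⟨ht0, ht.2⟩ htρ x hxball
  rw [hxx₀, Real.sqrt_mul' ν hTt.le] at hb
  -- `hb : ‖u t x‖ * (√(T-t) ‖ζ‖ + √ν √(T-t)) ≤ M`
  have hst : 0 < Real.sqrt (T - t) := Real.sqrt_pos.2 hTt
  have hsν : 0 < Real.sqrt ν := Real.sqrt_pos.2 hν
  have hkey : ‖physWindowField T x₀ u t ζ‖ * (‖ζ‖ + Real.sqrt ν) ≤ M := by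
    have : ‖physWindowField T x₀ u t ζ‖ = Real.sqrt (T - t) * ‖u t x‖ := by
      show ‖Real.sqrt (T - t) • u t (x₀ + Real.sqrt (T - t) • ζ)‖ = _
      rw [norm_smul, Real.norm_of_nonneg hst.le]
    rw [this]
    have hrw : Real.sqrt (T - t) * ‖u t x‖ * (‖ζ‖ + Real.sqrt ν) =
        ‖u t x‖ * (Real.sqrt (T - t) * ‖ζ‖ + Real.sqrt ν * Real.sqrt (T - t)) := by ring
    rw [hrw]; exact hb
  have hden : 0 < ‖ζ‖ + Real.sqrt ν := by positivity
  rw [le_div_iff₀ hsν]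
  calc ‖physWindowField T x₀ u t ζ‖ * Real.sqrt ν ≤ ‖physWindowField T x₀ u t ζ‖ * (‖ζ‖ + Real.sqrt ν) :=
        mul_le_mul_of_nonneg_left (by linarith [norm_nonneg ζ]) (norm_nonneg _)
    _ ≤ M := hkey
    _ ≤ |M| := le_abs_self M

/-- the physical-side schema hypothesis `PhysSmall (sinePhi U (cap ν M))` from pairwise `ε`-parallel vorticity moments +
local Type I (the cap penalty is discharged and the truncation is inactive, eventually). -/
theorem physSmall_sinePhi {ν T M ρ ε : ℝ} (hν : 0 < ν) (hT : 0 < T) (hρ : 0 < ρ)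
    {u : ℝ → EuclideanSpace ℝ (Fin 3) → EuclideanSpace ℝ (Fin 3)} {x₀ : EuclideanSpace ℝ (Fin 3)}
    {U : Set (EuclideanSpace ℝ (Fin 3))} (hUb : Bornology.IsBounded U)
    (hM : ∀ t ∈ Set.Ico 0 T, T - ρ ^ 2 < t → ∀ x ∈ Metric.ball x₀ ρ, ‖u t x‖ * (‖x - x₀‖ + Real.sqrt (ν * (T - t))) ≤ M)
    (hsmall : ∀ᶠ t in nhdsWithin T (Set.Iio T), ∀ g h : EuclideanSpace ℝ (Fin 3) → ℝ, IsTestWeight U g → IsTestWeight U h →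
      ‖cross (vortMoment g (physWindowField T x₀ u t)) (vortMoment h (physWindowField T x₀ u t))‖ ≤ ε) :
    PhysSmall (sinePhi U (cap ν M)) T x₀ u ε := by
  have hcapB : |M| / Real.sqrt ν < cap ν M := by unfold cap; linarith
  filter_upwards [hsmall, eventually_norm_physWindowField_le hν hT hρ hM hUb.closure] with t ht hcap
  set F := physWindowField T x₀ u t with hF
  have hpen : ∀ ζ ∈ closure U, ‖F ζ‖ ≤ cap ν M := fun ζ hζ => (hcap ζ hζ).trans hcapB.le
  have htm : ∀ g, IsTestWeight U g → truncMoment (cap ν M) g F = vortMoment g F := by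
    intro g hg
    unfold truncMoment vortMoment
    refine integral_congr_ae (Eventually.of_forall fun x => ?_)
    by_cases hx : x ∈ tsupport g
    · simp only [truncate_of_norm_le (cap_pos ν M) (hpen x (subset_closure (hg.2.2.1 hx)))]
    · simp only [gradient_eq_zero_off hx, ← crossCLM_apply, map_zero]
  show sinePhi U (cap ν M) F ≤ ENNReal.ofReal ε
  simp only [sinePhi, capPenalty, if_pos hpen, zero_add]
  refine iSup_le fun g => iSup_le fun h => iSup_le fun hg => iSup_le fun hh => ?_
  rw [htm g hg, htm h hh]
  exact ENNReal.ofReal_le_ofReal (ht g h hg hh)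

/-- **door T-sine is a THEOREM.** -/
theorem targetSineMoment_holds : TargetSineMoment := by
  intro ν M U hν hU hUb hne
  obtain ⟨ε, hε, hdoor⟩ := targetSineSchema_holds ν M U hν hU hne
  refine ⟨ε, hε, fun T hT u p hcl hLH hdec x₀ ρ hρ hM hsmall => ?_⟩
  exact hdoor T hT u p hcl hLH hdec x₀ ρ hρ hM (physSmall_sinePhi hν hT hρ hUb hM hsmall)

/-! ## §6 THE LEGIBLE COROLLARY: δ-UNIDIRECTIONAL WINDOW VORTICITY (transverse vorticity mass, axis free to rotate in
time) excludes local Type-I blow-up -/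

/-- **door T-transverse · `TargetTransverseVorticity` (PROVED: `targetTransverseVorticity_holds`).**  For every `ν > 0`,
`M` and open bounded nonempty window `U` there is `δ = δ(ν, M, U) > 0` such that: a classical Leray–Hopf solution with
rapidly decaying data, space–time local Type I (constant `M`) at `(x₀, T)`, for which at all times `t` close to `T⁻`
there is a unit axis `e = e_t` (FREE TO ROTATE with `t`) with TRANSVERSE WINDOW VORTICITY MASS
`∫_U ‖Ω_t(ζ) × e‖ dζ ≤ δ`, `Ω_t = curl F_t = (T−t) ω(t, x₀ + √(T−t)·)` the scale-normalised vorticity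
(`‖Ω × e‖ = ‖Ω‖ · sin∠(Ω, ±e)`: the Constantin–Fefferman sine against the axis, weighted by vorticity size), is backward
bounded at `(x₀, T)`.  No modulus, no vorticity threshold, no comparison between different points or times. -/
def TargetTransverseVorticity : Prop :=
  ∀ (ν M : ℝ) (U : Set (EuclideanSpace ℝ (Fin 3))), 0 < ν → IsOpen U → Bornology.IsBounded U → U.Nonempty →
    ∃ δ : ℝ, 0 < δ ∧ ∀ (T : ℝ), 0 < T →
    ∀ (u : ℝ → EuclideanSpace ℝ (Fin 3) → EuclideanSpace ℝ (Fin 3)) (p : ℝ → EuclideanSpace ℝ (Fin 3) → ℝ),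
    IsClassicalNSSolutionOn (Set.Ico 0 T) ν 0 u p → IsLerayHopfOn T ν 0 (u 0) u → HasRapidSpatialDecay (u 0) →
    ∀ (x₀ : EuclideanSpace ℝ (Fin 3)) (ρ : ℝ), 0 < ρ →
    (∀ t ∈ Set.Ico 0 T, T - ρ ^ 2 < t → ∀ x ∈ Metric.ball x₀ ρ, ‖u t x‖ * (‖x - x₀‖ + Real.sqrt (ν * (T - t))) ≤ M) →
    (∀ᶠ t in nhdsWithin T (Set.Iio T), ∃ e : EuclideanSpace ℝ (Fin 3), ‖e‖ = 1 ∧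
      ∫⁻ ζ in U, ENNReal.ofReal ‖cross (curl (physWindowField T x₀ u t) ζ) e‖ ≤ ENNReal.ofReal δ) →
    IsBackwardBoundedAt u T x₀

/-- the vector inequality behind the corollary: `‖a × b‖ ≤ ‖b‖ ‖a × e‖ + ‖a‖ ‖b × e‖` for a unit `e`
(decompose `b = ⟪b, e⟫ e + e × (b × e)`). -/
theorem norm_cross_le_of_unit (a b : EuclideanSpace ℝ (Fin 3)) {e : EuclideanSpace ℝ (Fin 3)} (he : ‖e‖ = 1) :
    ‖cross a b‖ ≤ ‖b‖ * ‖cross a e‖ + ‖a‖ * ‖cross b e‖ := by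
  have hdec : b = ⟪b, e⟫ • e + cross e (cross b e) := by
    rw [cross_cross_right, real_inner_self_eq_norm_sq, he, one_pow, one_smul, real_inner_comm]
    abel
  have hsplit : cross a b = ⟪b, e⟫ • cross a e + cross a (cross e (cross b e)) := by
    conv_lhs => rw [hdec]
    rw [← crossCLM_apply, map_add, map_smul, crossCLM_apply, crossCLM_apply]
  rw [hsplit]
  refine (norm_add_le _ _).trans (add_le_add ?_ ?_)
  · rw [norm_smul]
    exact mul_le_mul_of_nonneg_right ((abs_real_inner_le_norm b e).trans (by rw [he, mul_one])) (norm_nonneg _)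
  · refine (norm_cross_le_norm_mul_norm _ _).trans (mul_le_mul_of_nonneg_left ?_ (norm_nonneg _))
    exact (norm_cross_le_norm_mul_norm _ _).trans (by rw [he, one_mul])

/-- size of a moment: `‖m(g, F)‖ ≤ C · vol(U)` when `‖F‖ ≤ C` on `closure U`. -/
theorem norm_vortMoment_le {U : Set (EuclideanSpace ℝ (Fin 3))} (hU : IsOpen U) (hUfin : volume U ≠ ⊤)
    {g : EuclideanSpace ℝ (Fin 3) → ℝ} (hg : IsTestWeight U g) {F : EuclideanSpace ℝ (Fin 3) → EuclideanSpace ℝ (Fin 3)}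
    {C : ℝ} (hC : 0 ≤ C) (hFC : ∀ ζ ∈ closure U, ‖F ζ‖ ≤ C) : ‖vortMoment g F‖ ≤ C * (volume U).toReal := by
  unfold vortMoment
  have hbound : ∀ᵐ x ∂volume, ‖cross (F x) (gradient g x)‖ ≤ U.indicator (fun _ => C) x := by
    refine Eventually.of_forall fun x => ?_
    by_cases hx : x ∈ U
    · rw [indicator_of_mem hx]
      calc ‖cross (F x) (gradient g x)‖ ≤ ‖F x‖ * ‖gradient g x‖ := norm_cross_le_norm_mul_norm _ _
        _ ≤ C * 1 := mul_le_mul (hFC x (subset_closure hx)) (hg.norm_gradient_le x) (norm_nonneg _) hC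
        _ = C := mul_one C
    · rw [indicator_of_notMem hx, gradient_eq_zero_off (fun h => hx (hg.2.2.1 h)), ← crossCLM_apply, map_zero, norm_zero]
  have hint : Integrable (U.indicator fun _ => C) volume :=
    (integrable_indicator_iff hU.measurableSet).2 (integrableOn_const (hs := hUfin))
  refine (norm_integral_le_of_norm_le hint hbound).trans (le_of_eq ?_)
  rw [integral_indicator_const C hU.measurableSet, smul_eq_mul, mul_comm]
  rfl

/-- transverse size of a moment: `‖m(g, F) × e‖ ≤ ∫_U ‖curl F × e‖` for `F ∈ C¹`. -/
theorem norm_cross_vortMoment_le {U : Set (EuclideanSpace ℝ (Fin 3))} (hU : IsOpen U)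
    {g : EuclideanSpace ℝ (Fin 3) → ℝ} (hg : IsTestWeight U g) {F : EuclideanSpace ℝ (Fin 3) → EuclideanSpace ℝ (Fin 3)}
    (hF : ContDiff ℝ 1 F) (e : EuclideanSpace ℝ (Fin 3)) (hint : IntegrableOn (fun x => ‖cross (curl F x) e‖) U volume) :
    ‖cross (vortMoment g F) e‖ ≤ ∫ x in U, ‖cross (curl F x) e‖ := by
  rw [cross_vortMoment hF hg.contDiff hg.2.1]
  have hbound : ∀ᵐ x ∂volume, ‖g x • cross (curl F x) e‖ ≤ U.indicator (fun x => ‖cross (curl F x) e‖) x := by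
    refine Eventually.of_forall fun x => ?_
    by_cases hx : x ∈ U
    · rw [indicator_of_mem hx, norm_smul, Real.norm_eq_abs]
      calc |g x| * ‖cross (curl F x) e‖ ≤ 1 * ‖cross (curl F x) e‖ :=
            mul_le_mul_of_nonneg_right (hg.2.2.2 x).1 (norm_nonneg _)
        _ = ‖cross (curl F x) e‖ := one_mul _
    · have hgx : g x = 0 := image_eq_zero_of_notMem_tsupport fun h => hx (hg.2.2.1 h)
      rw [indicator_of_notMem hx, hgx, zero_smul, norm_zero]
  have hint' : Integrable (U.indicator fun x => ‖cross (curl F x) e‖) volume :=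
    (integrable_indicator_iff hU.measurableSet).2 hint
  refine (norm_integral_le_of_norm_le hint' hbound).trans (le_of_eq ?_)
  exact integral_indicator hU.measurableSet

/-- the physical window field of a classical solution is `C¹` at every time of existence. -/
theorem contDiff_physWindowField {ν T : ℝ} {u : ℝ → EuclideanSpace ℝ (Fin 3) → EuclideanSpace ℝ (Fin 3)}
    {p : ℝ → EuclideanSpace ℝ (Fin 3) → ℝ} (hcl : IsClassicalNSSolutionOn (Set.Ico 0 T) ν 0 u p) (x₀ : EuclideanSpace ℝ (Fin 3))
    {t : ℝ} (ht : t ∈ Set.Ico 0 T) : ContDiff ℝ 1 (physWindowField T x₀ u t) := by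
  have hu : ContDiff ℝ 1 (u t) := (hcl.contDiff_velocity ht).of_le (by simp)
  show ContDiff ℝ 1 fun y => Real.sqrt (T - t) • u t (x₀ + Real.sqrt (T - t) • y)
  exact (hu.comp (contDiff_const.add (contDiff_const_smul _))).const_smul _

/-- **door T-transverse is a THEOREM** (from `targetSineMoment_holds` by `norm_cross_le_of_unit`). -/
theorem targetTransverseVorticity_holds : TargetTransverseVorticity := by
  intro ν M U hν hU hUb hne
  obtain ⟨ε, hε, hdoor⟩ := targetSineMoment_holds ν M U hν hU hUb hne
  have hUfin : volume U ≠ ⊤ := hUb.measure_lt_top.ne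
  set A : ℝ := cap ν M * (volume U).toReal with hA
  have hA0 : 0 ≤ A := mul_nonneg (cap_pos ν M).le ENNReal.toReal_nonneg
  set δ : ℝ := ε / (2 * A + 1) with hδ
  have hδpos : 0 < δ := by rw [hδ]; positivity
  have hδε : 2 * A * δ ≤ ε := by
    have h1 : 2 * A * δ = ε - δ := by rw [hδ]; field_simp; ring
    rw [h1]; linarith
  refine ⟨δ, hδpos, fun T hT u p hcl hLH hdec x₀ ρ hρ hM htrans => ?_⟩
  refine hdoor T hT u p hcl hLH hdec x₀ ρ hρ hM ?_
  have hcapB : |M| / Real.sqrt ν < cap ν M := by unfold cap; linarith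
  filter_upwards [htrans, eventually_norm_physWindowField_le hν hT hρ hM hUb.closure, Ioo_mem_nhdsLT hT]
    with t ht hcap ht0T g h hg hh
  obtain ⟨e, he, hle⟩ := ht
  set F := physWindowField T x₀ u t with hF
  have hF1 : ContDiff ℝ 1 F := contDiff_physWindowField hcl x₀ ⟨ht0T.1.le, ht0T.2⟩
  have hFC : ∀ ζ ∈ closure U, ‖F ζ‖ ≤ cap ν M := fun ζ hζ => (hcap ζ hζ).trans hcapB.le
  -- the transverse vorticity mass is `≤ δ` (as a Bochner integral)
  have hcurl : Continuous (curl F) := by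
    rw [curl_eq_curlCLM_comp]
    exact curlCLM.continuous.comp (hF1.continuous_fderiv (by simp))
  have hGc : Continuous fun x => ‖cross (curl F x) e‖ := (continuous_cross_comp hcurl continuous_const).norm
  have hint : IntegrableOn (fun x => ‖cross (curl F x) e‖) U volume :=
    (hGc.continuousOn.integrableOn_compact hUb.isCompact_closure).mono_set subset_closure
  have htransR : ∫ x in U, ‖cross (curl F x) e‖ ≤ δ := by
    have hnn : 0 ≤ᵐ[volume.restrict U] fun x => ‖cross (curl F x) e‖ := Eventually.of_forall fun x => norm_nonneg _
    rw [integral_eq_lintegral_of_nonneg_ae hnn hGc.aestronglyMeasurable.restrict, ← ENNReal.toReal_ofReal hδpos.le]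
    exact ENNReal.toReal_mono ENNReal.ofReal_ne_top hle
  -- sizes and transverse sizes of the two moments
  have hmg : ‖vortMoment g F‖ ≤ A := norm_vortMoment_le hU hUfin hg (cap_pos ν M).le hFC
  have hmh : ‖vortMoment h F‖ ≤ A := norm_vortMoment_le hU hUfin hh (cap_pos ν M).le hFC
  have htg : ‖cross (vortMoment g F) e‖ ≤ δ := (norm_cross_vortMoment_le hU hg hF1 e hint).trans htransR
  have hth : ‖cross (vortMoment h F) e‖ ≤ δ := (norm_cross_vortMoment_le hU hh hF1 e hint).trans htransR
  calc ‖cross (vortMoment g F) (vortMoment h F)‖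
      ≤ ‖vortMoment h F‖ * ‖cross (vortMoment g F) e‖ + ‖vortMoment g F‖ * ‖cross (vortMoment h F) e‖ :=
        norm_cross_le_of_unit _ _ he
    _ ≤ A * δ + A * δ := add_le_add (mul_le_mul hmh htg (norm_nonneg _) hA0) (mul_le_mul hmg hth (norm_nonneg _) hA0)
    _ = 2 * A * δ := by ring
    _ ≤ ε := hδε


end Summit.NavierStokesRegularity.NavierStokesRegularity.Theorems.SineMomentDoor

end
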